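import Summits.BirchSwinnertonDyer.BirchSwinnertonDyer.Theorems.BiquadraticEisensteinDescentHeegnerTwistCouplingInSupplyKrizLiCornerClassNumber
import Summits.BirchSwinnertonDyer.BirchSwinnertonDyer.Theorems.BiquadraticEisensteinDescentHeegnerTwistCouplingInSupplyKrizLiCornerX12
import HarnessLib

set_option linter.dupNamespace false -- `Summit.BirchSwinnertonDyer.BirchSwinnertonDyer.Theorems.…` (summit = sub, D-0017)
set_option autoImplicit false

/-!
# Crux `HeegnerTwistCouplingInSupply` (stmt-BirchSwinnertonDyer-21381) — the Kriz–Li corners QT27₊ / X12₊ with CLASS-NUMBER certificates: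
# `3 ∤ h(−3q)` (resp. `3 ∤ h(−12q)`) and `3 ∤ h(−qr)` (resp. `3 ∤ h(−4qr)`) — KL3-CORNERS' (S3) verbatim

Route `BiquadraticEisensteinDescent` (cell `pub/bsd-wall`, width seat `bsd-wall-cm-bed-w4` g27; `--supports` 21381, helper). Sequel of
`…KrizLiCornerClassNumber.lean` (`natAbs_sum_mul_eq_mul_classNumber`: `|Σ_{b<f} χ(b)·b| = f·h(−f)` for a primitive odd quadratic `χ`
mod `f > 4`, from the tree's Dirichlet class number formula; the complex characters `(·/q)(·/r)`, `χ₄·(·/q)(·/r)`).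

* §1 ★ the certificate bridges: `three_dvd_S1_iff` (`q ≡ 1`, `r ≡ 3 (mod 4)`: `3 ∣ S₁(q,r) ↔ 3 ∣ h(−qr)`), `S2_iff` (`3 ∣ S₂(q)` always;
  `9 ∣ S₂(q) ↔ 3 ∣ h(−3q)`), `three_dvd_S1_chiFour_iff` (`q ≡ r ≡ 3 (mod 4)`: `3 ∣ S₁ ↔ 3 ∣ h(−4qr)`), `S2_chiFour_iff` (`9 ∣ S₂ ↔ 3 ∣ h(−12q)`);
* §2 ★ `KrizLiCornerQT27.exists_cruxConclusion_of_classNumbers` / `KrizLiCornerX12.exists_cruxConclusion_of_classNumbers`: the corner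
  theorems `exists_cruxConclusion_of_prime_pair(_three_mod_four)` with the integer certificates REPLACED by `3 ∤ h(−3q) ∧ 3 ∤ h(−qr)`
  (resp. `3 ∤ h(−12q) ∧ 3 ∤ h(−4qr)`) — kernel values of `BinQF.classNumber` — so that the crux's conclusion at `(W, q)` on the `j = 0`
  quadratic-twist corner reads, modulo Kriz–Li 1.20 + Gross–Zagier + Heegner points: «`q` KL3-regular and ONE prime `r` with
  `(−r/3) = (−r/q) = 1` [`(−r/2) = 1`], `3 ∤ h(ℚ(√(q·(−r))))`, `h(−r) < q`» = KL3-CORNERS-bsd-idea-18-g21 (S3)/(S3′) at `K′ = ℚ(√−r)`.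

HONEST FRAMING: a change of currency for the certificates (no new arithmetic input); conditional on the same three REFEREED named facts;
the crux (C⁺ / (S3′)(p) for ALL `p`, i.e. the EXISTENCE of such an `r` below `p²/(C log² p)` for every `p` — the root-lattice / A8
counting statements), its registered stubs and BSD are NOT proved by any of this. THEOREMS ONLY. Supports stmt-BirchSwinnertonDyer-21381.
[cite: Washington1997, Thm. 4.17] [cite: KrizLi2019, Thm. 1.20 (4) (p. 8)] [cite: Cox2013, §2.A Thm. 2.13; §7.B Thm. 7.7(ii)]
-/

noncomputable section

open scoped Classical NumberTheorySymbols

namespace Summit.BirchSwinnertonDyer.BirchSwinnertonDyer.Theorems.KrizLiCornerClassNumber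

open Finset DirichletCharacter
open Literature.NumberTheory.EllipticCurves Literature.NumberTheory.EllipticCurves.KrizLi2019
  Literature.NumberTheory.EllipticCurves.ModularForms
  Literature.NumberTheory.QuadraticFields Literature.NumberTheory.QuadraticFields.Quadratic
  Summit.BirchSwinnertonDyer.Rank1Residual.X12.O11.RouteU
  Summit.BirchSwinnertonDyer.BirchSwinnertonDyer.Theorems.PrintCFram

/-! ## §1 ★ The certificate bridges: `S₁`, `S₂` are class numbers -/

section Bridges

/-- ★ **`3 ∣ S₁(q, r) ↔ 3 ∣ h(−qr)`** for primes `q ≡ 1 (mod 4)`, `r ≡ 3 (mod 4)`, both `≠ 3`: the first certificate of the QT27₊ corner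
(`KrizLiCornerQT27.exists_cruxConclusion_of_prime_pair`, cell `bsd-print-cfram`'s `bsdp_three_of_unitRegime_prime_pair`) is the
`3`-indivisibility of the class number of `ℚ(√(q·d_{K′}))`, `d_{K′} = −r` — KL3-CORNERS (S3). (`|S₁| = qr·h(−qr)`.)
[cite: Washington1997, Thm. 4.17] [cite: KrizLi2019, Thm. 1.20 (4) (p. 8)] -/
theorem three_dvd_S1_iff {q r : ℕ} [hq : Fact q.Prime] [hr : Fact r.Prime] (hq4 : q % 4 = 1) (hr4 : r % 4 = 3)
    (hq3 : q ≠ 3) (hr3 : r ≠ 3) :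
    (3 : ℤ) ∣ ∑ j ∈ range (q * r), legendreSym q (j : ℤ) * legendreSym r (j : ℤ) * (j : ℤ) ↔
      3 ∣ BinQF.classNumber (-((q * r : ℕ) : ℤ)) := by
  have hq2 : q ≠ 2 := by omega
  have hr2 : r ≠ 2 := by omega
  have hqr : q ≠ r := by omega
  haveI : NeZero (q * r) := ⟨mul_ne_zero hq.out.ne_zero hr.out.ne_zero⟩
  obtain ⟨χ, hprim, hχ⟩ := exists_legendrePairChar hq2 hr2 hqr
  have hf : 4 < q * r := by
    have := hq.out.two_le; have := hr.out.two_le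
    have h5 : 5 ≤ q := by omega
    nlinarith
  have hf3 : ¬ 3 ∣ q * r := by
    rw [Nat.Prime.dvd_mul Nat.prime_three, not_or]
    exact ⟨fun h => hq3 ((Nat.prime_dvd_prime_iff_eq Nat.prime_three hq.out).mp h).symm,
      fun h => hr3 ((Nat.prime_dvd_prime_iff_eq Nat.prime_three hr.out).mp h).symm⟩
  exact three_dvd_sum_iff hf hf3 χ hprim
    (isQuadratic_of_values χ hχ fun b => trichotomy_mul (legendreSym_trichotomy _ _) (legendreSym_trichotomy _ _))
    (legendrePairChar_odd hq4 hr4 χ hχ) hχ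

/-- ★ **`3 ∣ S₂(q)` always, and `9 ∣ S₂(q) ↔ 3 ∣ h(−3q)`** for a prime `q ≡ 1 (mod 4)`, `q ≠ 3`: the second certificate `3 ∥ S₂(q)` of
the QT27₊ corner is the KL3-regularity `3 ∤ h(ℚ(√−3q))` of KL3-CORNERS §1. (`|S₂| = 3q·h(−3q)`; the exponent `0 + 1` is the corner
files' literal shape.) [cite: Washington1997, Thm. 4.17] [cite: KrizLi2019, Thm. 1.20 (4) (p. 8)] -/
theorem S2_iff {q : ℕ} [hq : Fact q.Prime] (hq4 : q % 4 = 1) (hq3 : q ≠ 3) :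
    (3 : ℤ) ∣ ∑ j ∈ range (q * 3), legendreSym q (j : ℤ) * legendreSym 3 (j : ℤ) * (j : ℤ) ^ (0 + 1) ∧
      ((3 : ℤ) ^ 2 ∣ ∑ j ∈ range (q * 3), legendreSym q (j : ℤ) * legendreSym 3 (j : ℤ) * (j : ℤ) ^ (0 + 1) ↔
        3 ∣ BinQF.classNumber (-((q * 3 : ℕ) : ℤ))) := by
  haveI : Fact (Nat.Prime 3) := ⟨Nat.prime_three⟩
  have hq2 : q ≠ 2 := by omega
  haveI : NeZero (q * 3) := ⟨mul_ne_zero hq.out.ne_zero (by norm_num)⟩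
  obtain ⟨χ, hprim, hχ⟩ := exists_legendrePairChar (q := q) (r := 3) hq2 (by norm_num) hq3
  have hf : 4 < q * 3 := by have := hq.out.two_le; omega
  simp_rw [zero_add, pow_one]
  exact nine_dvd_sum_iff hf (dvd_mul_left 3 q) (fun h => hq3 (by
      have h' : 3 * 3 ∣ 3 * q := by rwa [mul_comm 3 q]
      exact ((Nat.prime_dvd_prime_iff_eq Nat.prime_three hq.out).mp (Nat.dvd_of_mul_dvd_mul_left (by norm_num) h')).symm))
    χ hprim (isQuadratic_of_values χ hχ fun b => trichotomy_mul (legendreSym_trichotomy _ _) (legendreSym_trichotomy _ _))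
    (legendrePairChar_odd hq4 (by norm_num) χ hχ) hχ

/-- ★ **`3 ∣ S₁(q, r) ↔ 3 ∣ h(−4qr)`** for primes `q ≡ r ≡ 3 (mod 4)`, distinct, both `≠ 3`, `S₁ = Σ_{j<4qr} χ₄(j)(j/q)(j/r)·j`: the first
certificate of the X12₊ corner (`KrizLiCornerX12.exists_cruxConclusion_of_prime_pair_three_mod_four`) is `3 ∤ h(ℚ(√−qr))` (discriminant
`−4qr`). (`|S₁| = 4qr·h(−4qr)`.) [cite: Washington1997, Thm. 4.17] [cite: KrizLi2019, Thm. 1.20 (4) (p. 8)] -/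
theorem three_dvd_S1_chiFour_iff {q r : ℕ} [hq : Fact q.Prime] [hr : Fact r.Prime] (hq4 : q % 4 = 3) (hr4 : r % 4 = 3)
    (hqr : q ≠ r) (hq3 : q ≠ 3) (hr3 : r ≠ 3) :
    (3 : ℤ) ∣ ∑ j ∈ range (4 * q * r), (ZMod.χ₄ (j : ZMod 4) * J((j : ℤ) | q) : ℤ) * jacobiSym (j : ℤ) r * (j : ℤ) ↔
      3 ∣ BinQF.classNumber (-((4 * q * r : ℕ) : ℤ)) := by
  have hq2 : q ≠ 2 := by omega
  have hr2 : r ≠ 2 := by omega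
  haveI : NeZero (4 * q * r) := ⟨mul_ne_zero (mul_ne_zero (by norm_num) hq.out.ne_zero) hr.out.ne_zero⟩
  obtain ⟨χ, hprim, hχ⟩ := exists_chiFourPairChar hq2 hr2 hqr
  have hf : 4 < 4 * q * r := by
    have := hq.out.two_le; have := hr.out.two_le; nlinarith
  have hf3 : ¬ 3 ∣ 4 * q * r := by
    intro h
    rcases (Nat.Prime.dvd_mul Nat.prime_three).mp h with h' | h'
    · rcases (Nat.Prime.dvd_mul Nat.prime_three).mp h' with h'' | h''
      · norm_num at h''
      · exact hq3 ((Nat.prime_dvd_prime_iff_eq Nat.prime_three hq.out).mp h'').symm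
    · exact hr3 ((Nat.prime_dvd_prime_iff_eq Nat.prime_three hr.out).mp h').symm
  simp_rw [← jacobiSym.legendreSym.to_jacobiSym]
  exact three_dvd_sum_iff hf hf3 χ hprim
    (isQuadratic_of_values χ hχ fun b =>
      trichotomy_mul (trichotomy_mul (chiFour_trichotomy _) (legendreSym_trichotomy _ _)) (legendreSym_trichotomy _ _))
    (chiFourPairChar_odd hq4 hr4 χ hχ) hχ

/-- ★ **`3 ∣ S₂(q)` always, and `9 ∣ S₂(q) ↔ 3 ∣ h(−12q)`** for a prime `q ≡ 3 (mod 4)`, `q ≠ 3`, `S₂ = Σ_{j<12q} χ₄(j)(j/q)(j/3)·j`: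
the second certificate of the X12₊ corner is the KL3-regularity `3 ∤ h(−12q)` of KL3-CORNERS §1. (`|S₂| = 12q·h(−12q)`.)
[cite: Washington1997, Thm. 4.17] [cite: KrizLi2019, Thm. 1.20 (4) (p. 8)] -/
theorem S2_chiFour_iff {q : ℕ} [hq : Fact q.Prime] (hq4 : q % 4 = 3) (hq3 : q ≠ 3) :
    (3 : ℤ) ∣ ∑ j ∈ range (4 * q * 3), (ZMod.χ₄ (j : ZMod 4) * J((j : ℤ) | q) : ℤ) * jacobiSym (j : ℤ) 3 * (j : ℤ) ^ (0 + 1) ∧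
      ((3 : ℤ) ^ 2 ∣ ∑ j ∈ range (4 * q * 3),
          (ZMod.χ₄ (j : ZMod 4) * J((j : ℤ) | q) : ℤ) * jacobiSym (j : ℤ) 3 * (j : ℤ) ^ (0 + 1) ↔
        3 ∣ BinQF.classNumber (-((4 * q * 3 : ℕ) : ℤ))) := by
  haveI : Fact (Nat.Prime 3) := ⟨Nat.prime_three⟩
  have hq2 : q ≠ 2 := by omega
  haveI : NeZero (4 * q * 3) := ⟨mul_ne_zero (mul_ne_zero (by norm_num) hq.out.ne_zero) (by norm_num)⟩
  obtain ⟨χ, hprim, hχ⟩ := exists_chiFourPairChar (q := q) (r := 3) hq2 (by norm_num) hq3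
  have hf : 4 < 4 * q * 3 := by have := hq.out.two_le; omega
  have h9 : ¬ 9 ∣ 4 * q * 3 := by
    intro h
    have h' : 3 * 3 ∣ 3 * (4 * q) := by rw [show 3 * (4 * q) = 4 * q * 3 by ring]; exact h
    have h'' := Nat.dvd_of_mul_dvd_mul_left (by norm_num) h'
    rcases (Nat.Prime.dvd_mul Nat.prime_three).mp h'' with h3 | h3
    · norm_num at h3
    · exact hq3 ((Nat.prime_dvd_prime_iff_eq Nat.prime_three hq.out).mp h3).symm
  simp_rw [zero_add, pow_one, ← jacobiSym.legendreSym.to_jacobiSym]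
  exact nine_dvd_sum_iff hf (dvd_mul_left 3 _) h9 χ hprim
    (isQuadratic_of_values χ hχ fun b =>
      trichotomy_mul (trichotomy_mul (chiFour_trichotomy _) (legendreSym_trichotomy _ _)) (legendreSym_trichotomy _ _))
    (chiFourPairChar_odd hq4 (by norm_num) χ hχ) hχ

end Bridges

/-! ## §2 ★ The corners with class-number certificates -/

section Corners

/-- ★ **QT27₊ (`q ≡ 5 (mod 12)`) with CLASS-NUMBER certificates.** As `KrizLiCornerQT27.exists_cruxConclusion_of_prime_pair`, with the
integer certificates `3 ∤ S₁(q,r)`, `3 ∥ S₂(q)` REPLACED by `3 ∤ h(−qr)` and `3 ∤ h(−3q)` (`BinQF.classNumber`, kernel values) via §1: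
for primes `q ≡ 1 (mod 4)` with `J(3 | q) = −1`, `r ≡ 3 (mod 4)`, `r ≠ 3`, `J(−r | 3) = J(−r | q) = 1`, `3 ∤ h(−3q)`, `3 ∤ h(−qr)`,
`h(−r) < q`, and every globally minimal `W ≅ y² = x³ + q·m²` (bad primes `⊂ {3, q} ∪ listed`, `a₂ = 0` if good at `2`, `r_an(W) ≠ 0`):
the CONCLUSION of crux 21381 at `(W, q)`, modulo `hKL`, `hGZ`, `hHP`. [cite: KrizLi2019, Thm. 1.20 (pp. 7–8)] [cite: Washington1997, Thm. 4.17]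
[cite: GrossZagier1986, Thm. I.(6.3), V.§1–2] -/
theorem exists_cruxConclusion_of_classNumbers (hKL : thm120_padicLogHeegner_unit_of_bernoulli)
    (hGZ : ∀ (N : ℕ) [NeZero N] (W : WeierstrassCurve ℚ) (K : Type) [Field K] [NumberField K], gross_zagier N W K)
    (hHP : ∀ (W : WeierstrassCurve ℚ) (K : Type) [Field K] [NumberField K], exists_isHeegnerPoint W K)
    {q r : ℕ} [hq : Fact q.Prime] [hrp : Fact r.Prime] (hq4 : q % 4 = 1) (hr4 : r % 4 = 3)
    (hr3 : r ≠ 3) (h1 : jacobiSym 3 q = -1)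
    (hs3 : jacobiSym (-(r : ℤ)) 3 = 1) (hsq : jacobiSym (-(r : ℤ)) q = 1)
    (h3q : ¬ 3 ∣ BinQF.classNumber (-((q * 3 : ℕ) : ℤ))) (hqr : ¬ 3 ∣ BinQF.classNumber (-((q * r : ℕ) : ℤ)))
    {h : ℕ} (hclass : BinQF.classNumber (-(r : ℤ)) = h) (hhq : h < q)
    (W : WeierstrassCurve ℚ) [W.IsElliptic] [W.IsGloballyMinimal] [NeZero (W.conductorNorm ℤ)]
    {m : ℤ} (hm : m ≠ 0) (hW : ∃ C : WeierstrassCurve.VariableChange ℚ, C • W = mordellCurve ((q : ℚ) * (m : ℚ) ^ 2))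
    (h6 : ∀ ℓ : ℕ, ℓ.Prime → ¬ ((ℓ : ℤ) ^ 6 ∣ (q : ℤ) * m ^ 2))
    (h2 : (haveI : Fact (Nat.Prime 2) := ⟨Nat.prime_two⟩; W.HasGoodReductionAtPrime 2) →
      W.LFunction 2 = 0)
    (hS : ∀ ℓ : ℕ, (hℓ : ℓ.Prime) → ¬ (haveI := Fact.mk hℓ; W.HasGoodReductionAtPrime ℓ) →
      ℓ = 3 ∨ ℓ = q ∨ (ℓ % 3 = 1 ∧ jacobiSym (ℓ : ℤ) q = -1 ∧ jacobiSym (-(r : ℤ)) ℓ = 1))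
    (hr1 : W.analyticRank ≠ 0) :
    ∃ (K : Type) (_ : Field K) (_ : NumberField K),
      IsImaginaryQuadratic K ∧ 4 < (NumberField.discr K).natAbs ∧
      SatisfiesHeegnerHypothesis (W.conductorNorm ℤ) K ∧
      (W.quadraticTwist (NumberField.discr K : ℚ)).entireLFunction 1 ≠ 0 ∧ ¬ q ∣ NumberField.classNumber K := by
  have hq3 : q ≠ 3 := by
    rintro rfl
    rw [jacobiSym.eq_zero_iff.mpr ⟨by norm_num, by decide⟩] at h1
    norm_num at h1
  have hS₁ : ¬ ((3 : ℤ) ∣ ∑ j ∈ range (q * r), legendreSym q (j : ℤ) * legendreSym r (j : ℤ) * (j : ℤ)) := by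
    rw [three_dvd_S1_iff hq4 hr4 hq3 hr3]; exact hqr
  obtain ⟨hS₂, hS₂iff⟩ := S2_iff hq4 hq3
  exact KrizLiCornerQT27.exists_cruxConclusion_of_prime_pair hKL hGZ hHP hq4 hr4 hr3 h1 hs3 hsq hS₁ hS₂
    (fun h9 => h3q (hS₂iff.mp h9)) hclass hhq W hm hW h6 h2 hS hr1

/-- ★ **X12₊ ∪ QT27₊ (`q ≡ 11 (mod 12)`) with CLASS-NUMBER certificates.** As
`KrizLiCornerX12.exists_cruxConclusion_of_prime_pair_three_mod_four`, with the integer certificates REPLACED by `3 ∤ h(−4qr)` and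
`3 ∤ h(−12q)` via §1: for primes `q ≡ 3 (mod 4)` with `J(3 | q) = 1`, `r ≡ 7 (mod 8)`, `r ≠ 3`, `J(−r | 3) = J(−r | q) = 1`,
`3 ∤ h(−12q)`, `3 ∤ h(−4qr)`, `h(−r) < q`, and every globally minimal `W ≅ y² = x³ + q·m²` (bad primes `⊂ {2, 3, q}`, `a₂ = 0` if good
at `2`, `r_an(W) ≠ 0`): the CONCLUSION of crux 21381 at `(W, q)`, modulo `hKL`, `hGZ`, `hHP`. [cite: KrizLi2019, Thm. 1.20 (pp. 7–8)]
[cite: Washington1997, Thm. 4.17] [cite: GrossZagier1986, Thm. I.(6.3), V.§1–2] -/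
theorem exists_cruxConclusion_three_mod_four_of_classNumbers (hKL : thm120_padicLogHeegner_unit_of_bernoulli)
    (hGZ : ∀ (N : ℕ) [NeZero N] (W : WeierstrassCurve ℚ) (K : Type) [Field K] [NumberField K], gross_zagier N W K)
    (hHP : ∀ (W : WeierstrassCurve ℚ) (K : Type) [Field K] [NumberField K], exists_isHeegnerPoint W K)
    {q r : ℕ} [hq : Fact q.Prime] [hrp : Fact r.Prime] (hq4 : q % 4 = 3) (h3j : jacobiSym 3 q = 1)
    (hr8 : r % 8 = 7) (hr3 : r ≠ 3) (hs3 : jacobiSym (-(r : ℤ)) 3 = 1) (hsq : jacobiSym (-(r : ℤ)) q = 1)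
    (h12q : ¬ 3 ∣ BinQF.classNumber (-((4 * q * 3 : ℕ) : ℤ))) (h4qr : ¬ 3 ∣ BinQF.classNumber (-((4 * q * r : ℕ) : ℤ)))
    {h : ℕ} (hclass : BinQF.classNumber (-(r : ℤ)) = h) (hhq : h < q)
    (W : WeierstrassCurve ℚ) [W.IsElliptic] [W.IsGloballyMinimal] [NeZero (W.conductorNorm ℤ)]
    {m : ℤ} (hm : m ≠ 0) (hW : ∃ C : WeierstrassCurve.VariableChange ℚ, C • W = mordellCurve ((q : ℚ) * (m : ℚ) ^ 2))
    (h6 : ∀ ℓ : ℕ, ℓ.Prime → ¬ ((ℓ : ℤ) ^ 6 ∣ (q : ℤ) * m ^ 2))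
    (h2 : (haveI : Fact (Nat.Prime 2) := ⟨Nat.prime_two⟩; W.HasGoodReductionAtPrime 2) →
      W.LFunction 2 = 0)
    (hS : ∀ ℓ : ℕ, (hℓ : ℓ.Prime) → ¬ (haveI := Fact.mk hℓ; W.HasGoodReductionAtPrime ℓ) →
      ℓ = 2 ∨ ℓ = 3 ∨ ℓ = q)
    (hr1 : W.analyticRank ≠ 0) :
    ∃ (K : Type) (_ : Field K) (_ : NumberField K),
      IsImaginaryQuadratic K ∧ 4 < (NumberField.discr K).natAbs ∧
      SatisfiesHeegnerHypothesis (W.conductorNorm ℤ) K ∧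
      (W.quadraticTwist (NumberField.discr K : ℚ)).entireLFunction 1 ≠ 0 ∧ ¬ q ∣ NumberField.classNumber K := by
  have hq3 : q ≠ 3 := by
    rintro rfl
    rw [jacobiSym.mod_left] at h3j
    norm_num [jacobiSym.zero_left] at h3j
  have hr4 : r % 4 = 3 := by omega
  have hqr : q ≠ r := by
    rintro rfl
    rw [jacobiSym.mod_left, show (-(q : ℤ)) % q = 0 by simp, jacobiSym.zero_left hq.out.one_lt] at hsq
    norm_num at hsq
  have hS₁ : ¬ ((3 : ℤ) ∣ ∑ j ∈ range (4 * q * r),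
      (ZMod.χ₄ (j : ZMod 4) * J((j : ℤ) | q) : ℤ) * jacobiSym (j : ℤ) r * (j : ℤ)) := by
    rw [three_dvd_S1_chiFour_iff hq4 hr4 hqr hq3 hr3]; exact h4qr
  obtain ⟨hS₂, hS₂iff⟩ := S2_chiFour_iff hq4 hq3
  exact KrizLiCornerX12.exists_cruxConclusion_of_prime_pair_three_mod_four hKL hGZ hHP hq4 h3j hr8 hr3 hs3 hsq hS₁ hS₂
    (fun h9 => h12q (hS₂iff.mp h9)) hclass hhq W hm hW h6 h2 hS hr1

end Corners

end Summit.BirchSwinnertonDyer.BirchSwinnertonDyer.Theorems.KrizLiCornerClassNumber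

end
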